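/-
Copyright (c) 2026 the pub-hodgecm-mathlib formalisation cell (harness21).  Prover seat hodgecm-mathlib-LA3-p01 (g0), P6 «MOD programme», half A line L3,
organ **(ν8R-coh)** — the coherence half of (ν8R) «the valuation-ring model of a reduced homomorphism» (LA3-plan 2026-09-02 04:00:01Z «(c) =»); 2026-09-02.
-/
import Literature.AlgebraicGeometry.AbelianSchemes.AbelianSchemeBaseChangeComp
import Literature.AlgebraicGeometry.AbelianSchemes.AbelianSchemeFibreBaseChangeHom
import Literature.AlgebraicGeometry.AbelianSchemes.AbelianSchemeFibreFrobeniusTwist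
import Literature.AlgebraicGeometry.AbelianSchemes.AbelianSchemeFibreHom
import Literature.AlgebraicGeometry.AbelianSchemes.AbelianSchemeEquivariantFibreTransport   -- ★ `toSchemeHom_comp`, `fibre_hom_ext_of_toSchemeHom_fst`
import HarnessLib

/-!
# THE FIVE-PIECE ALONG-STAGE ISOMORPHISM, CONTINUED TO A MODEL OVER A FINER BASE, IS THE THREE-PIECE ISOMORPHISM
# (coherence of the fibre identifications of ★ (ν6)∕(ν8) with those of ★ (d5) `AbelianSchemeFibreAlongIntegralPoint`; [GortzWedhorn2020] (4.7), [SerreTate1968] §1)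

Topic `AlgebraicGeometry/AbelianSchemes`, namespace `Literature.AlgebraicGeometry.AbelianSchemes.AbelianSchemeOver`.  THEOREMS ONLY (no definition, no named fact, no
instance, no notation).  Cell `hodgecm-mathlib` (D-0151), F0∕P6 «MOD», organ **(ν8R-coh)**.  SETTING: an abelian scheme `𝒜 → T`; a stage `V′ → V → T` (`g`, `z`) and a
finer base `r : V_r → V′` (think: `V_r = Spec R` the valuation ring of a point, `V′ = Spec D′` a finite Dedekind stage under it), so that the `R`-MODEL `𝒜_{x_R}`,
`x_R := (r ≫ g) ≫ z`, is `((𝒜_z)_{V′})_{V_r}` up to the transitivity isomorphisms (★ `baseChangeCompGrpIso`); a restricted family `𝒜|_U` (`j : U → T`) and points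
`y` of `U`, `a` of `V`, `η_r` of `V_r` over the same point of `T` (`hpt : y ≫ j = a ≫ z`, `e : (η_r ≫ r) ≫ g = a`, `hpr : y ≫ j = η_r ≫ x_R`).
§0 `fibre_baseChange_hom_ext`: a morphism of abelian varieties into a fibre `(X ×_T S′)_s` is determined by its component in `X`; the projections of ★ `fibreCongrPtIso`,
★ `fibreBaseChangeIso⁻¹`.  §1 HEAD `fibreHom_comp_five_inv_eq_three_inv`: the fibre at `η_r` of the transitivity isomorphism `𝒜_{x_R} → ((𝒜_z)_{V′})_{V_r}`, followed by
`(((𝒜_z)_{V′})_{V_r})_{η_r} ≅ ((𝒜_z)_{V′})_{η_r ≫ r}` and by the INVERSE of the five-piece isomorphism `(𝒜|_U)_y ≅ ((𝒜_z)_{V′})_{η_r ≫ r}` of ★ (ν6) §1, IS the inverse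
three-piece isomorphism `(𝒜_{x_R})_{η_r} ≅ 𝒜_{η_r ≫ x_R} = 𝒜_{y ≫ j} ≅ (𝒜|_U)_y` of ★ (d5) — every piece commutes with the projections to `𝒜`.
Consumer: ★ (ν8R) `AbelianSchemeHomReductionValuationModel` (kernel readings of a reduced homomorphism along a flat `𝒦 ↪ 𝒜_{x_R}`).

HONEST LABEL: HC_CM is proved only modulo the cell's 2 remaining named inputs (hLiu418 24832, h413 24833) until rung 0 closes; generic capital on
`--supports stmt-HodgeConjecture-24832`, pays no letter.

## References
* [GortzWedhorn2020] U. Görtz, T. Wedhorn, *Algebraic Geometry I*, 2nd ed. (2020), Section (4.7) (p. 135), Prop. 4.16, Remark 16.54 (p. 678).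
* [SerreTate1968] J.-P. Serre, J. Tate, *Good reduction of abelian varieties*, Ann. of Math. 88 (1968), §1.
* [MumfordFogartyKirwan1994] D. Mumford, J. Fogarty, F. Kirwan, *GIT*, 3rd ed., Ch. 7 §2 Definition 7.2 (p. 129).
-/

set_option autoImplicit false

noncomputable section

set_option backward.isDefEq.respectTransparency false

universe u

open CategoryTheory CategoryTheory.Limits AlgebraicGeometry MonoidalCategory CartesianMonoidalCategory
open scoped MonObj CategoryTheory.Obj
open Literature.AlgebraicGeometry.Motives

namespace Literature.AlgebraicGeometry.AbelianSchemes

namespace AbelianSchemeOver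

section Ext

/-! ### §0 Bookkeeping: a morphism into a fibre `(X ×_T S′)_s` is determined by its component in `X` -/

variable {T S' : Scheme.{u}} (X : AbelianSchemeOver T) (f : S' ⟶ T) {Ω : Type u} [Field Ω] (s : Spec (.of Ω) ⟶ S')

/-- **A morphism of abelian varieties into the fibre `(X ×_T S′)_s` is determined by its component in `X`** (twice the universal property of the
fibre product; the base components are forced). [cite: GortzWedhorn2020, Section (4.7) (p. 135), Prop. 4.16] -/
theorem fibre_baseChange_hom_ext {F : AbelianVariety Ω} (φ₁ φ₂ : F ⟶ ((X.baseChange f).fibre s).toAbelianVariety)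
    (h : AbelianVariety.Hom.toSchemeHom φ₁ ≫ pullback.fst (pullback.snd X.X.hom f) s ≫ pullback.fst X.X.hom f =
      AbelianVariety.Hom.toSchemeHom φ₂ ≫ pullback.fst (pullback.snd X.X.hom f) s ≫ pullback.fst X.X.hom f) : φ₁ = φ₂ := by
  apply AbelianVariety.hom_ext
  ext : 1
  have w₁ : φ₁.hom.hom.hom.left ≫ pullback.snd (pullback.snd X.X.hom f) s = F.X.hom := Over.w φ₁.hom.hom.hom
  have w₂ : φ₂.hom.hom.hom.left ≫ pullback.snd (pullback.snd X.X.hom f) s = F.X.hom := Over.w φ₂.hom.hom.hom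
  apply pullback.hom_ext
  · apply pullback.hom_ext
    · change (φ₁.hom.hom.hom.left ≫ pullback.fst (pullback.snd X.X.hom f) s) ≫ pullback.fst X.X.hom f =
        (φ₂.hom.hom.hom.left ≫ pullback.fst (pullback.snd X.X.hom f) s) ≫ pullback.fst X.X.hom f
      simpa only [Category.assoc] using h
    · change (φ₁.hom.hom.hom.left ≫ pullback.fst (pullback.snd X.X.hom f) s) ≫ pullback.snd X.X.hom f =
        (φ₂.hom.hom.hom.left ≫ pullback.fst (pullback.snd X.X.hom f) s) ≫ pullback.snd X.X.hom f
      rw [Category.assoc, Category.assoc, pullback.condition, ← Category.assoc, ← Category.assoc, w₁, w₂]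
  · change φ₁.hom.hom.hom.left ≫ pullback.snd (pullback.snd X.X.hom f) s = φ₂.hom.hom.hom.left ≫ pullback.snd (pullback.snd X.X.hom f) s
    rw [w₁, w₂]

/-- `fibreCongrPtIso` commutes with the projections to `X`. [cite: GortzWedhorn2020, Section (4.7) (p. 135)] -/
theorem fibreCongrPtIso_hom_toSchemeHom_fst {s₁ s₂ : Spec (.of Ω) ⟶ T} (h : s₁ = s₂) :
    AbelianVariety.Hom.toSchemeHom (X.fibreCongrPtIso h).hom ≫ pullback.fst X.X.hom s₂ = pullback.fst X.X.hom s₁ := by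
  subst h
  simp only [fibreCongrPtIso, eqToIso_refl, Iso.refl_hom]
  exact Category.id_comp _

/-- `fibreCongrPtIso⁻¹` commutes with the projections to `X`. [cite: GortzWedhorn2020, Section (4.7) (p. 135)] -/
theorem fibreCongrPtIso_inv_toSchemeHom_fst {s₁ s₂ : Spec (.of Ω) ⟶ T} (h : s₁ = s₂) :
    AbelianVariety.Hom.toSchemeHom (X.fibreCongrPtIso h).inv ≫ pullback.fst X.X.hom s₁ = pullback.fst X.X.hom s₂ := by
  subst h
  simp only [fibreCongrPtIso, eqToIso_refl, Iso.refl_inv]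
  exact Category.id_comp _

/-- `fibreBaseChangeIso⁻¹` commutes with the projections to `X`. [cite: GortzWedhorn2020, Section (4.7) (p. 135)] -/
theorem fibreBaseChangeIso_inv_toSchemeHom_fst_fst :
    AbelianVariety.Hom.toSchemeHom (X.fibreBaseChangeIso f s).inv ≫ pullback.fst (pullback.snd X.X.hom f) s ≫ pullback.fst X.X.hom f =
      pullback.fst X.X.hom (s ≫ f) :=
  X.baseChangeCompGrpIso_hom_left_fst_fst f s

end Ext

section Coherence

/-! ### §1 Coherence: the five-piece along-stage isomorphism, continued to the `R`-model, IS the three-piece isomorphism -/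

variable {T V V' Vr Ug : Scheme.{u}} {Ω : Type u} [Field Ω]
  (j : Ug ⟶ T) (z : V ⟶ T) (g : V' ⟶ V) (r : Vr ⟶ V') (y : Spec (.of Ω) ⟶ Ug) (a : Spec (.of Ω) ⟶ V) (ηr : Spec (.of Ω) ⟶ Vr)
  (hpt : y ≫ j = a ≫ z) (e : (ηr ≫ r) ≫ g = a) (hpr : y ≫ j = ηr ≫ (r ≫ g) ≫ z) (𝒜 : AbelianSchemeOver T)

set_option maxHeartbeats 400000 in
/-- **COHERENCE.**  The fibre at `η_r` of the transitivity isomorphism `𝒜_{x_R} ≅ ((𝒜_z)_{V′})_{V_r}`, followed by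
`(((𝒜_z)_{V′})_{V_r})_{η_r} ≅ ((𝒜_z)_{V′})_{η_r ≫ r}` and the INVERSE five-piece isomorphism, IS the inverse three-piece isomorphism `(𝒜_{x_R})_{η_r} ≅ (𝒜|_U)_y`.
[cite: GortzWedhorn2020, Section (4.7) (p. 135), Prop. 4.16] -/
theorem fibreHom_comp_five_inv_eq_three_inv :
    fibreHom ((𝒜.baseChangeCompGrpIso z (r ≫ g)).hom.hom.hom ≫ ((𝒜.baseChange z).baseChangeCompGrpIso g r).hom.hom.hom) ηr ≫
        (((𝒜.baseChange z).baseChange g).fibreBaseChangeIso r ηr).hom ≫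
        (𝒜.fibreBaseChangeIso j y ≪≫ 𝒜.fibreCongrPtIso hpt ≪≫ (𝒜.fibreBaseChangeIso z a).symm ≪≫ ((𝒜.baseChange z).fibreCongrPtIso e).symm ≪≫
          ((𝒜.baseChange z).fibreBaseChangeIso g (ηr ≫ r)).symm).inv =
      (𝒜.fibreBaseChangeIso j y ≪≫ 𝒜.fibreCongrPtIso hpr ≪≫ (𝒜.fibreBaseChangeIso ((r ≫ g) ≫ z) ηr).symm).inv := by
  apply fibre_baseChange_hom_ext 𝒜 j y
  have g1 : AbelianVariety.Hom.toSchemeHom (𝒜.fibreBaseChangeIso j y).inv ≫ pullback.fst (pullback.snd 𝒜.X.hom j) y ≫ pullback.fst 𝒜.X.hom j =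
      pullback.fst 𝒜.X.hom (y ≫ j) := by
    exact fibreBaseChangeIso_inv_toSchemeHom_fst_fst 𝒜 j y
  have g2 : AbelianVariety.Hom.toSchemeHom (𝒜.fibreCongrPtIso hpt).inv ≫ pullback.fst 𝒜.X.hom (y ≫ j) = pullback.fst 𝒜.X.hom (a ≫ z) := by
    exact fibreCongrPtIso_inv_toSchemeHom_fst 𝒜 hpt
  have g2' : AbelianVariety.Hom.toSchemeHom (𝒜.fibreCongrPtIso hpr).inv ≫ pullback.fst 𝒜.X.hom (y ≫ j) = pullback.fst 𝒜.X.hom (ηr ≫ (r ≫ g) ≫ z) := by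
    exact fibreCongrPtIso_inv_toSchemeHom_fst 𝒜 hpr
  have g3 : AbelianVariety.Hom.toSchemeHom (𝒜.fibreBaseChangeIso z a).hom ≫ pullback.fst 𝒜.X.hom (a ≫ z) =
      pullback.fst (pullback.snd 𝒜.X.hom z) a ≫ pullback.fst 𝒜.X.hom z := by
    exact 𝒜.fibreBaseChangeIso_hom_toSchemeHom_fst z a
  have g3' : AbelianVariety.Hom.toSchemeHom (𝒜.fibreBaseChangeIso ((r ≫ g) ≫ z) ηr).hom ≫ pullback.fst 𝒜.X.hom (ηr ≫ (r ≫ g) ≫ z) =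
      pullback.fst (pullback.snd 𝒜.X.hom ((r ≫ g) ≫ z)) ηr ≫ pullback.fst 𝒜.X.hom ((r ≫ g) ≫ z) := by
    exact 𝒜.fibreBaseChangeIso_hom_toSchemeHom_fst ((r ≫ g) ≫ z) ηr
  have g4 : AbelianVariety.Hom.toSchemeHom ((𝒜.baseChange z).fibreCongrPtIso e).hom ≫ pullback.fst (pullback.snd 𝒜.X.hom z) a =
      pullback.fst (pullback.snd 𝒜.X.hom z) ((ηr ≫ r) ≫ g) := by
    exact fibreCongrPtIso_hom_toSchemeHom_fst (𝒜.baseChange z) e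
  have g5 : AbelianVariety.Hom.toSchemeHom ((𝒜.baseChange z).fibreBaseChangeIso g (ηr ≫ r)).hom ≫ pullback.fst (pullback.snd 𝒜.X.hom z) ((ηr ≫ r) ≫ g) =
      pullback.fst (pullback.snd (pullback.snd 𝒜.X.hom z) g) (ηr ≫ r) ≫ pullback.fst (pullback.snd 𝒜.X.hom z) g := by
    exact (𝒜.baseChange z).fibreBaseChangeIso_hom_toSchemeHom_fst g (ηr ≫ r)
  have g6 : AbelianVariety.Hom.toSchemeHom (((𝒜.baseChange z).baseChange g).fibreBaseChangeIso r ηr).hom ≫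
        pullback.fst (pullback.snd (pullback.snd 𝒜.X.hom z) g) (ηr ≫ r) =
      pullback.fst (pullback.snd (pullback.snd (pullback.snd 𝒜.X.hom z) g) r) ηr ≫ pullback.fst (pullback.snd (pullback.snd 𝒜.X.hom z) g) r := by
    exact ((𝒜.baseChange z).baseChange g).fibreBaseChangeIso_hom_toSchemeHom_fst r ηr
  have g7 : AbelianVariety.Hom.toSchemeHom (fibreHom ((𝒜.baseChangeCompGrpIso z (r ≫ g)).hom.hom.hom ≫
        ((𝒜.baseChange z).baseChangeCompGrpIso g r).hom.hom.hom) ηr) ≫ pullback.fst (pullback.snd (pullback.snd (pullback.snd 𝒜.X.hom z) g) r) ηr =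
      pullback.fst (pullback.snd 𝒜.X.hom ((r ≫ g) ≫ z)) ηr ≫
        ((𝒜.baseChangeCompGrpIso z (r ≫ g)).hom.hom.hom ≫ ((𝒜.baseChange z).baseChangeCompGrpIso g r).hom.hom.hom).left := by
    exact fibreHom_toSchemeHom_fst _ ηr
  have g8 : ((𝒜.baseChangeCompGrpIso z (r ≫ g)).hom.hom.hom ≫ ((𝒜.baseChange z).baseChangeCompGrpIso g r).hom.hom.hom).left ≫
        pullback.fst (pullback.snd (pullback.snd 𝒜.X.hom z) g) r ≫ pullback.fst (pullback.snd 𝒜.X.hom z) g ≫ pullback.fst 𝒜.X.hom z =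
      pullback.fst 𝒜.X.hom ((r ≫ g) ≫ z) := by
    have e1 : (𝒜.baseChangeCompGrpIso z (r ≫ g)).hom.hom.hom.left ≫ pullback.fst (pullback.snd 𝒜.X.hom z) (r ≫ g) ≫ pullback.fst 𝒜.X.hom z =
        pullback.fst 𝒜.X.hom ((r ≫ g) ≫ z) := by
      exact 𝒜.baseChangeCompGrpIso_hom_left_fst_fst z (r ≫ g)
    have e2 : ((𝒜.baseChange z).baseChangeCompGrpIso g r).hom.hom.hom.left ≫ pullback.fst (pullback.snd (pullback.snd 𝒜.X.hom z) g) r ≫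
        pullback.fst (pullback.snd 𝒜.X.hom z) g = pullback.fst (pullback.snd 𝒜.X.hom z) (r ≫ g) := by
      exact (𝒜.baseChange z).baseChangeCompGrpIso_hom_left_fst_fst g r
    simp only [Over.comp_left, Category.assoc]
    rw [reassoc_of% e2, e1]
  simp only [Iso.trans_inv, Iso.symm_inv, toSchemeHom_comp, Category.assoc]
  rw [g1, g2, g3, reassoc_of% g4, reassoc_of% g5, reassoc_of% g6, reassoc_of% g7, g8, g2', g3']

end Coherence

end AbelianSchemeOver

end Literature.AlgebraicGeometry.AbelianSchemes

end
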